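import Literature.Analysis.FunctionSpaces.PolchinskiEquation
import Mathlib.Analysis.Calculus.Deriv.Pow
import Mathlib.Analysis.Calculus.Deriv.Inv
import Mathlib.Analysis.Calculus.Deriv.Mul
import HarnessLib

/-!
# The generator of the Polchinski semigroup: `∂_t P_{0,t}F = L_t P_{0,t}F`
# (Bauerschmidt–Bodineau–Dagallier, Proposition 8, first generator identity)

Topic `Literature/Analysis/FunctionSpaces`; fourth "proof architecture" file behind the named fact
`Polchinski.BauerschmidtBodineau_multiscaleBakryEmery` ([BBD] Theorem 3, `MultiscaleBakryEmery.lean`),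
after `PolchinskiSemigroup.lean` (Props 6, 8 algebraic part), `PolchinskiHeatEquation.lean` (Prop 5)
and `PolchinskiEquation.lean` (Prop 7).  Here: the differential part of [BBD] **Proposition 8**
(p0014 L91–104): «for all `t` at which `C_t` is differentiable, `∂_t P_{s,t}F = L_t P_{s,t}F`, where
`L_t F = ½ Δ_{Ċ_t} F − (∇V_t, ∇F)_{Ċ_t}`», in the case `s = 0` used by the proof of Theorem 3
(`F_t = P_{0,t}F`, (e:dEnt) and Lemma 1), together with the spatial regularity of `P_{0,t}F` that the
identity presupposes.  Printed proof (p0015 L9–32): write `F_{0,t} = P_{0,t}F = e^{V_t} E_{C_t}[e^{−V₀}F(·+ζ)]`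
and differentiate with Props 5 and 7.  We follow it in the equivalent quotient form
`P_{0,t}F = W_t/Z_t`, `W_t(φ) = E_{C_t}[e^{−V₀}F(φ+ζ)]`, `Z_t(φ) = E_{C_t}[e^{−V₀(φ+ζ)}] = e^{−V_t(φ)}`,
applying Prop 5 (`hasDerivAt_integral_gaussian`) to both `W_t` and `Z_t`; the algebra
`∂_t(W/Z) = ½Δ_{Ċ}(W/Z) − (∇V,∇(W/Z))_{Ċ}` with `∇V = −∇Z/Z` is the displayed computation of [BBD].

## Main results (sorry-free; no new definitions, no new named facts)

* `hasFDerivAt_semigroup_zero` — `P_{0,t}F` is Fréchet differentiable in `φ`, with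
  `∇P_{0,t}F = ∇W_t/Z_t − W_t ∇Z_t/Z_t²`.
* `hasDerivAt_semigroup_zero` — the time derivative in quotient (heat) form,
  `∂_t P_{0,t}F(φ) = −(∂_tZ_t) W_t/Z_t² + (∂_t W_t)/Z_t` with `∂_t Z_t = ½Δ_{Ċ_t}Z_t`, `∂_t W_t = ½Δ_{Ċ_t}W_t`.
* **`hasDerivAt_semigroup_zero_eq_generator`** — **[BBD] Prop 8, (e:polchinski-generator) at `s = 0`**:
  for `t > 0` there are a gradient field `gP` of `P_{0,t}F` (certified at every point) and a Hessian
  `HP` of it at `φ` such that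
  `∂_t P_{0,t}F(φ) = ½ Σ_{ij} Ċ_t^{ij} HP(e_i,e_j) − Σ_{ij} Ċ_t^{ij} ∂_iV_t(φ) gP(φ)(e_j)`,
  `∇V_t(φ)` being the derivative certified by `hasFDerivAt_renormPotential`.  (Fréchet derivatives
  are unique, so the existential packaging loses nothing; it only hides the long closed form of `HP`.)
* `hasDerivAt_comp_semigroup_zero` — the integrand of the entropy-production formula (e:dEnt)
  (proof of [BBD] Thm 3): for `Φ ∈ C²`, `(∂_t − L_t)Φ(P_{0,t}F) = −½ Φ''(P_{0,t}F)(∇P_{0,t}F)²_{Ċ_t}`,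
  with the derivatives of `Φ(P_{0,t}F)` certified by the chain rule.

Setting and hypotheses: `D : Polchinski.CovDecomposition N` (possibly DEGENERATE positive semidefinite
`Ċ_t`); `V₀` bounded below with `e^{−V₀}` twice Fréchet differentiable, `∇e^{−V₀}` bounded, `D²e^{−V₀}`
bounded and uniformly continuous; `F` bounded with `e^{−V₀}F` twice Fréchet differentiable, `∇(e^{−V₀}F)`
bounded, `D²(e^{−V₀}F)` bounded and uniformly continuous (all true for `V₀, F ∈ C²` with bounded,
uniformly continuous derivatives up to order two and `V₀` bounded below, `F` bounded — the printed
«smooth `F`» plus boundedness).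
-- TODO(general form): general `s ≤ t` (`∂_t P_{s,t}F = L_tP_{s,t}F`, via the shifted decomposition
-- `C_{s+τ} − C_s`), the backward identity `−∂_s P_{s,t}F = P_{s,t}L_sF`, and `−∂_t E_{ν_t}F = E_{ν_t}L_tF`
-- (needed to integrate `hasDerivAt_comp_semigroup_zero` into (e:dEnt)); Lemma 1 (Bochner formula).
Nothing here concerns Yang–Mills.

## References

* [BauerschmidtBodineauDagallier2023] R. Bauerschmidt, T. Bodineau, B. Dagallier, Probab. Surveys 21
  (2024) 200–290, arXiv:2307.07619 — Proposition 8 p0014 L77–113, proof p0015 L1–33. READ (held).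
* [BauerschmidtBodineau2021SineGordonLSI] R. Bauerschmidt, T. Bodineau, CPAM 74 (2021), §2.
  READ (held).
-/

noncomputable section

open MeasureTheory ProbabilityTheory Filter Topology Set
open scoped RealInnerProductSpace Matrix MatrixOrder

namespace Literature.Analysis.FunctionSpaces

namespace Polchinski

variable {N : ℕ}

section Generator

variable (D : CovDecomposition N) {V₀ : EuclideanSpace ℝ (Fin N) → ℝ}
  {D1 : EuclideanSpace ℝ (Fin N) → EuclideanSpace ℝ (Fin N) →L[ℝ] ℝ}
  {D2 : EuclideanSpace ℝ (Fin N) → EuclideanSpace ℝ (Fin N) →L[ℝ] EuclideanSpace ℝ (Fin N) →L[ℝ] ℝ}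
  {F : EuclideanSpace ℝ (Fin N) → ℝ}
  {DK : EuclideanSpace ℝ (Fin N) → EuclideanSpace ℝ (Fin N) →L[ℝ] ℝ}
  {D2K : EuclideanSpace ℝ (Fin N) → EuclideanSpace ℝ (Fin N) →L[ℝ] EuclideanSpace ℝ (Fin N) →L[ℝ] ℝ}

/-- `V₀` is measurable and `|e^{−V₀}| ≤ e^{−b}`, `|e^{−V₀}F| ≤ e^{−b} K_F` under the standing
hypotheses. [folklore] -/
private theorem basic_bounds
    (hG1 : ∀ x, HasFDerivAt (fun x => Real.exp (-V₀ x)) (D1 x) x) {b : ℝ} (hb : ∀ φ, b ≤ V₀ φ)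
    {KF : ℝ} (hFb : ∀ x, |F x| ≤ KF) :
    Measurable V₀ ∧ (∀ x, |Real.exp (-V₀ x)| ≤ Real.exp (-b)) ∧
      (∀ x, |Real.exp (-V₀ x) * F x| ≤ Real.exp (-b) * KF) ∧
      ∀ x, ‖Real.exp (-V₀ x) * F x‖ ≤ Real.exp (-b) * KF := by
  have hc : Continuous fun x => Real.exp (-V₀ x) :=
    continuous_iff_continuousAt.2 fun x => (hG1 x).continuousAt
  have he : V₀ = fun x => -Real.log (Real.exp (-V₀ x)) := by
    funext x; rw [Real.log_exp, neg_neg]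
  have hV : Measurable V₀ := by
    rw [he]
    exact (Real.measurable_log.comp hc.measurable).neg
  have h1 : ∀ x, |Real.exp (-V₀ x)| ≤ Real.exp (-b) := fun x => by
    rw [abs_of_pos (Real.exp_pos _)]
    exact Real.exp_le_exp.2 (neg_le_neg (hb x))
  have h2 : ∀ x, |Real.exp (-V₀ x) * F x| ≤ Real.exp (-b) * KF := fun x => by
    rw [abs_mul]
    exact mul_le_mul (h1 x) (hFb x) (abs_nonneg _) (Real.exp_pos _).le
  refine ⟨hV, h1, h2, fun x => ?_⟩
  rw [Real.norm_eq_abs]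
  exact h2 x

/-- Evaluation of an integrated second derivative on basis vectors:
`(E[D²G(φ+ζ)]) e_i e_j = E[D²G(φ+ζ)(e_i,e_j)]` (via uniqueness of Fréchet derivatives of
`ψ ↦ E[DG(ψ+ζ)] e_j`, avoiding integrability bookkeeping for operator-valued integrands). [folklore] -/
private theorem integral_fderiv₂_apply_single
    {G1 : EuclideanSpace ℝ (Fin N) → EuclideanSpace ℝ (Fin N) →L[ℝ] ℝ}
    {G2 : EuclideanSpace ℝ (Fin N) → EuclideanSpace ℝ (Fin N) →L[ℝ] EuclideanSpace ℝ (Fin N) →L[ℝ] ℝ}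
    (hG2 : ∀ x, HasFDerivAt G1 (G2 x) x) {K1 : ℝ}
    (hK1 : ∀ x, ‖G1 x‖ ≤ K1) {M : ℝ} (hM : ∀ x, ‖G2 x‖ ≤ M) (hG2c : Continuous G2)
    (P : Measure (EuclideanSpace ℝ (Fin N))) [IsProbabilityMeasure P]
    (φ : EuclideanSpace ℝ (Fin N)) (i j : Fin N) :
    (∫ ζ, G2 (φ + ζ) ∂P) (EuclideanSpace.single i 1) (EuclideanSpace.single j 1) =
      ∫ ζ, G2 (φ + ζ) (EuclideanSpace.single i 1) (EuclideanSpace.single j 1) ∂P := by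
  have hG1c : Continuous G1 := continuous_iff_continuousAt.2 fun x => (hG2 x).continuousAt
  set w : EuclideanSpace ℝ (Fin N) := EuclideanSpace.single j 1 with hw
  set u : EuclideanSpace ℝ (Fin N) := EuclideanSpace.single i 1 with hu
  set ev := ContinuousLinearMap.apply ℝ ℝ w with hev
  have hA : HasFDerivAt (fun ψ => ev (∫ ζ, G1 (ψ + ζ) ∂P)) (ev.comp (∫ ζ, G2 (φ + ζ) ∂P)) φ :=
    ev.hasFDerivAt.comp φ (hasFDerivAt_integral_shift hG2 hG2c hK1 hM P φ)
  have hB : HasFDerivAt (fun ψ => ∫ ζ, G1 (ψ + ζ) w ∂P) (∫ ζ, ev.comp (G2 (φ + ζ)) ∂P) φ := by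
    refine hasFDerivAt_integral_shift (G := fun x => G1 x w) (D1 := fun x => ev.comp (G2 x))
      (fun x => ?_) (((ContinuousLinearMap.compL ℝ _ _ ℝ ev).continuous).comp hG2c)
      (K0 := K1 * ‖w‖) (fun x => ?_) (K1 := ‖ev‖ * M) (fun x => ?_) P φ
    · have h := ev.hasFDerivAt.comp x (hG2 x)
      have hf : (fun x => G1 x w) = (⇑ev ∘ G1) := by funext y; simp [hev]
      rw [hf]
      exact h
    · calc ‖G1 x w‖ ≤ ‖G1 x‖ * ‖w‖ := ContinuousLinearMap.le_opNorm _ _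
        _ ≤ K1 * ‖w‖ := mul_le_mul_of_nonneg_right (hK1 x) (norm_nonneg _)
    · calc ‖ev.comp (G2 x)‖ ≤ ‖ev‖ * ‖G2 x‖ := ContinuousLinearMap.opNorm_comp_le _ _
        _ ≤ ‖ev‖ * M := mul_le_mul_of_nonneg_left (hM x) (norm_nonneg ev)
  have hI1 : ∀ ψ, Integrable (fun ζ => G1 (ψ + ζ)) P := fun ψ =>
    Integrable.of_bound (hG1c.comp (continuous_const.add continuous_id)).aestronglyMeasurable K1
      (Eventually.of_forall fun ζ => hK1 (ψ + ζ))
  have hfun : (fun ψ => ev (∫ ζ, G1 (ψ + ζ) ∂P)) = fun ψ => ∫ ζ, G1 (ψ + ζ) w ∂P := by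
    funext ψ
    rw [hev, ContinuousLinearMap.apply_apply, ContinuousLinearMap.integral_apply (hI1 ψ) w]
  rw [hfun] at hA
  have huniq := hA.unique hB
  have hI2 : Integrable (fun ζ => ev.comp (G2 (φ + ζ))) P :=
    Integrable.of_bound ((((ContinuousLinearMap.compL ℝ _ _ ℝ ev).continuous).comp hG2c).comp
      (continuous_const.add continuous_id)).aestronglyMeasurable (‖ev‖ * M)
      (Eventually.of_forall fun ζ => by
        calc ‖ev.comp (G2 (φ + ζ))‖ ≤ ‖ev‖ * ‖G2 (φ + ζ)‖ := ContinuousLinearMap.opNorm_comp_le _ _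
          _ ≤ ‖ev‖ * M := mul_le_mul_of_nonneg_left (hM _) (norm_nonneg ev))
  have h := congrArg (fun L : EuclideanSpace ℝ (Fin N) →L[ℝ] ℝ => L u) huniq
  simp only [ContinuousLinearMap.comp_apply, hev, ContinuousLinearMap.apply_apply] at h
  rw [h, ContinuousLinearMap.integral_apply hI2 u]
  simp [hev]

/-- **Spatial gradient of the Polchinski semigroup at `s = 0`.**  With `Z_t(ψ) = E_{C_t}[e^{−V₀(ψ+ζ)}]`
and `W_t(ψ) = E_{C_t}[e^{−V₀(ψ+ζ)}F(ψ+ζ)]` one has `P_{0,t}F = W_t/Z_t` ([BBD] (e:P-def-bis) with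
`e^{V_t} = 1/Z_t`), hence `∇P_{0,t}F = ∇W_t/Z_t − W_t∇Z_t/Z_t²` with `∇W_t = E_{C_t}[∇(e^{−V₀}F)(ψ+ζ)]`,
`∇Z_t = E_{C_t}[∇e^{−V₀}(ψ+ζ)]` (the spatial regularity of `P_{s,t}F` presupposed in [BBD] Prop 8 /
Lemma 2).  Valid for every `t` (no differentiability of `C_t` needed).
[cite: BauerschmidtBodineauDagallier2023, Proposition 8 (proof, (e:P-def-bis))] -/
theorem hasFDerivAt_semigroup_zero
    (hG1 : ∀ x, HasFDerivAt (fun x => Real.exp (-V₀ x)) (D1 x) x)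
    (hG2 : ∀ x, HasFDerivAt D1 (D2 x) x) {b : ℝ} (hb : ∀ φ, b ≤ V₀ φ)
    {K1 : ℝ} (hK1 : ∀ x, ‖D1 x‖ ≤ K1)
    (hF1 : ∀ x, HasFDerivAt (fun x => Real.exp (-V₀ x) * F x) (DK x) x)
    (hF2 : ∀ x, HasFDerivAt DK (D2K x) x) {KF : ℝ} (hFb : ∀ x, |F x| ≤ KF)
    {L1 : ℝ} (hL1 : ∀ x, ‖DK x‖ ≤ L1) (t : ℝ) (φ : EuclideanSpace ℝ (Fin N)) :
    HasFDerivAt (fun ψ => semigroup D V₀ 0 t F ψ)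
      ((∫ ζ, Real.exp (-V₀ (φ + ζ)) ∂(multivariateGaussian 0 (D.C t)))⁻¹ •
          (∫ ζ, DK (φ + ζ) ∂(multivariateGaussian 0 (D.C t))) +
        (∫ ζ, Real.exp (-V₀ (φ + ζ)) * F (φ + ζ) ∂(multivariateGaussian 0 (D.C t))) •
          ((-((∫ ζ, Real.exp (-V₀ (φ + ζ)) ∂(multivariateGaussian 0 (D.C t))) ^ 2)⁻¹) •
            ∫ ζ, D1 (φ + ζ) ∂(multivariateGaussian 0 (D.C t)))) φ := by
  obtain ⟨hV, -, -, hKb⟩ := basic_bounds hG1 hb hFb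
  have hDKc : Continuous DK := continuous_iff_continuousAt.2 fun x => (hF2 x).continuousAt
  have hZ := hasFDerivAt_integral_exp_neg D hG1 hG2 hb hK1 t φ
  have hne : (∫ ζ, Real.exp (-V₀ (φ + ζ)) ∂(multivariateGaussian 0 (D.C t))) ≠ 0 :=
    (integral_exp_neg_pos hV hb _ φ).ne'
  have hinv : HasFDerivAt
      (fun ψ => (∫ ζ, Real.exp (-V₀ (ψ + ζ)) ∂(multivariateGaussian 0 (D.C t)))⁻¹)
      ((-((∫ ζ, Real.exp (-V₀ (φ + ζ)) ∂(multivariateGaussian 0 (D.C t))) ^ 2)⁻¹) •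
        ∫ ζ, D1 (φ + ζ) ∂(multivariateGaussian 0 (D.C t))) φ :=
    (hasDerivAt_inv hne).comp_hasFDerivAt φ hZ
  have hW : HasFDerivAt
      (fun ψ => ∫ ζ, Real.exp (-V₀ (ψ + ζ)) * F (ψ + ζ) ∂(multivariateGaussian 0 (D.C t)))
      (∫ ζ, DK (φ + ζ) ∂(multivariateGaussian 0 (D.C t))) φ :=
    hasFDerivAt_integral_shift (G := fun x => Real.exp (-V₀ x) * F x) hF1 hDKc hKb hL1 _ φ
  have hP : (fun ψ => semigroup D V₀ 0 t F ψ) = fun ψ =>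
      (∫ ζ, Real.exp (-V₀ (ψ + ζ)) ∂(multivariateGaussian 0 (D.C t)))⁻¹ *
        ∫ ζ, Real.exp (-V₀ (ψ + ζ)) * F (ψ + ζ) ∂(multivariateGaussian 0 (D.C t)) := by
    funext ψ
    rw [semigroup_zero_eq, exp_renormPotential_eq_inv D hV hb]
  rw [hP]
  exact hinv.fun_mul hW

/-- **Time derivative of the Polchinski semigroup at `s = 0`, quotient (heat) form**: for `t > 0`,
`∂_t P_{0,t}F(φ) = −(∂_tZ_t(φ)) W_t(φ)/Z_t(φ)² + ∂_tW_t(φ)/Z_t(φ)` with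
`∂_tZ_t = ½ Σ Ċ_t^{ij} E_{C_t}[∂_i∂_j e^{−V₀}(φ+ζ)]` and `∂_tW_t = ½ Σ Ċ_t^{ij} E_{C_t}[∂_i∂_j(e^{−V₀}F)(φ+ζ)]`
(two applications of [BBD] Prop 5 — the first line of the displayed computation p0015 L19–21).
[cite: BauerschmidtBodineauDagallier2023, Proposition 8 (proof)] -/
theorem hasDerivAt_semigroup_zero
    (hG1 : ∀ x, HasFDerivAt (fun x => Real.exp (-V₀ x)) (D1 x) x)
    (hG2 : ∀ x, HasFDerivAt D1 (D2 x) x) {b : ℝ} (hb : ∀ φ, b ≤ V₀ φ)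
    {M : ℝ} (hM : ∀ x, ‖D2 x‖ ≤ M) (hUC : UniformContinuous D2)
    (hF1 : ∀ x, HasFDerivAt (fun x => Real.exp (-V₀ x) * F x) (DK x) x)
    (hF2 : ∀ x, HasFDerivAt DK (D2K x) x) {KF : ℝ} (hFb : ∀ x, |F x| ≤ KF)
    {M' : ℝ} (hM' : ∀ x, ‖D2K x‖ ≤ M') (hUC' : UniformContinuous D2K)
    {t : ℝ} (ht : 0 < t) (φ : EuclideanSpace ℝ (Fin N)) :
    HasDerivAt (fun s => semigroup D V₀ 0 s F φ)
      (-((1 / 2) * ∑ i, ∑ j, D.Cdot t i j *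
            ∫ x, D2 (φ + x) (EuclideanSpace.single i 1) (EuclideanSpace.single j 1)
              ∂(multivariateGaussian 0 (D.C t))) /
            (∫ ζ, Real.exp (-V₀ (φ + ζ)) ∂(multivariateGaussian 0 (D.C t))) ^ 2 *
          (∫ ζ, Real.exp (-V₀ (φ + ζ)) * F (φ + ζ) ∂(multivariateGaussian 0 (D.C t))) +
        (∫ ζ, Real.exp (-V₀ (φ + ζ)) ∂(multivariateGaussian 0 (D.C t)))⁻¹ *
          ((1 / 2) * ∑ i, ∑ j, D.Cdot t i j *
            ∫ x, D2K (φ + x) (EuclideanSpace.single i 1) (EuclideanSpace.single j 1)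
              ∂(multivariateGaussian 0 (D.C t)))) t := by
  obtain ⟨hV, hGb, hKb, -⟩ := basic_bounds hG1 hb hFb
  have hZt := hasDerivAt_integral_gaussian D hG1 hG2 hGb hM hUC ht φ
  have hWt : HasDerivAt
      (fun s => ∫ x, Real.exp (-V₀ (φ + x)) * F (φ + x) ∂(multivariateGaussian 0 (D.C s)))
      ((1 / 2) * ∑ i, ∑ j, D.Cdot t i j *
        ∫ x, D2K (φ + x) (EuclideanSpace.single i 1) (EuclideanSpace.single j 1)
          ∂(multivariateGaussian 0 (D.C t))) t :=
    hasDerivAt_integral_gaussian D (G := fun x => Real.exp (-V₀ x) * F x) hF1 hF2 hKb hM' hUC' ht φ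
  have hne : (∫ ζ, Real.exp (-V₀ (φ + ζ)) ∂(multivariateGaussian 0 (D.C t))) ≠ 0 :=
    (integral_exp_neg_pos hV hb _ φ).ne'
  have hP : (fun s => semigroup D V₀ 0 s F φ) = fun s =>
      (∫ ζ, Real.exp (-V₀ (φ + ζ)) ∂(multivariateGaussian 0 (D.C s)))⁻¹ *
        ∫ ζ, Real.exp (-V₀ (φ + ζ)) * F (φ + ζ) ∂(multivariateGaussian 0 (D.C s)) := by
    funext s
    rw [semigroup_zero_eq, exp_renormPotential_eq_inv D hV hb]
  rw [hP]
  exact (hZt.fun_inv hne).fun_mul hWt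

/-- **[BBD] Proposition 8 — the generator of the Polchinski semigroup, `∂_t P_{0,t}F = L_t P_{0,t}F`.**
Let `C_t` be a covariance decomposition (`Polchinski.CovDecomposition`, possibly degenerate positive
semidefinite `Ċ_t`), `V₀` bounded below with `e^{−V₀}` twice Fréchet differentiable (`∇e^{−V₀}` bounded,
`D²e^{−V₀}` bounded and uniformly continuous) and `F` bounded with `e^{−V₀}F` twice Fréchet
differentiable (same bounds).  Then for every `t > 0` and `φ ∈ ℝ^N` there exist a gradient field `gP`
of `P_{0,t}F` — `∇(P_{0,t}F)(ψ) = gP ψ` at every `ψ` — and its Fréchet derivative `HP = Hess(P_{0,t}F)(φ)`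
at `φ` such that
`∂_t P_{0,t}F(φ) = ½ Σ_{ij} Ċ_t^{ij} HP(e_i,e_j) − Σ_{ij} Ċ_t^{ij} ∂_iV_t(φ) · gP(φ)(e_j)`,
i.e. `∂_t P_{0,t}F = ½Δ_{Ċ_t}P_{0,t}F − (∇V_t, ∇P_{0,t}F)_{Ċ_t} = L_t P_{0,t}F` ((e:polchinski-generator),
first identity, at `s = 0`; (e:polchinski-L)), where `∇V_t(φ) = −∇Z_t(φ)/Z_t(φ)` is the derivative
certified by `hasFDerivAt_renormPotential`.  Since Fréchet derivatives are unique, `gP` and `HP` are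
THE first and second derivatives of `P_{0,t}F`; explicitly `gP` is the one of `hasFDerivAt_semigroup_zero`.
Proof as printed (p0015 L9–32), in quotient form `P_{0,t}F = W_t/Z_t`: Prop 5 for `Z_t` and `W_t`
(`hasDerivAt_semigroup_zero`), the spatial derivatives of `W_t/Z_t`, and the identity
`−Ż W/Z² + Ẇ/Z = ½Δ_{Ċ}(W/Z) − (∇V, ∇(W/Z))_{Ċ}` (uses the symmetry of `Ċ_t`).
[cite: BauerschmidtBodineauDagallier2023, Proposition 8] -/
theorem hasDerivAt_semigroup_zero_eq_generator
    (hG1 : ∀ x, HasFDerivAt (fun x => Real.exp (-V₀ x)) (D1 x) x)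
    (hG2 : ∀ x, HasFDerivAt D1 (D2 x) x) {b : ℝ} (hb : ∀ φ, b ≤ V₀ φ)
    {K1 : ℝ} (hK1 : ∀ x, ‖D1 x‖ ≤ K1) {M : ℝ} (hM : ∀ x, ‖D2 x‖ ≤ M) (hUC : UniformContinuous D2)
    (hF1 : ∀ x, HasFDerivAt (fun x => Real.exp (-V₀ x) * F x) (DK x) x)
    (hF2 : ∀ x, HasFDerivAt DK (D2K x) x) {KF : ℝ} (hFb : ∀ x, |F x| ≤ KF)
    {L1 : ℝ} (hL1 : ∀ x, ‖DK x‖ ≤ L1) {M' : ℝ} (hM' : ∀ x, ‖D2K x‖ ≤ M')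
    (hUC' : UniformContinuous D2K) {t : ℝ} (ht : 0 < t) (φ : EuclideanSpace ℝ (Fin N)) :
    ∃ (gP : EuclideanSpace ℝ (Fin N) → EuclideanSpace ℝ (Fin N) →L[ℝ] ℝ)
      (HP : EuclideanSpace ℝ (Fin N) →L[ℝ] EuclideanSpace ℝ (Fin N) →L[ℝ] ℝ),
      (∀ ψ, HasFDerivAt (fun ψ => semigroup D V₀ 0 t F ψ) (gP ψ) ψ) ∧
      HasFDerivAt gP HP φ ∧
      HasDerivAt (fun s => semigroup D V₀ 0 s F φ)
        ((1 / 2) * ∑ i, ∑ j, D.Cdot t i j *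
            HP (EuclideanSpace.single i 1) (EuclideanSpace.single j 1) -
          ∑ i, ∑ j, D.Cdot t i j *
            (-((∫ ζ, Real.exp (-V₀ (φ + ζ)) ∂(multivariateGaussian 0 (D.C t)))⁻¹ •
                ∫ ζ, D1 (φ + ζ) ∂(multivariateGaussian 0 (D.C t)))) (EuclideanSpace.single i 1) *
              gP φ (EuclideanSpace.single j 1)) t := by
  -- names for the six Gaussian averages at `φ`
  set Z : ℝ := ∫ ζ, Real.exp (-V₀ (φ + ζ)) ∂(multivariateGaussian 0 (D.C t)) with hZdef
  set gZ : EuclideanSpace ℝ (Fin N) →L[ℝ] ℝ := ∫ ζ, D1 (φ + ζ) ∂(multivariateGaussian 0 (D.C t))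
    with hgZdef
  set HZ : EuclideanSpace ℝ (Fin N) →L[ℝ] EuclideanSpace ℝ (Fin N) →L[ℝ] ℝ :=
    ∫ ζ, D2 (φ + ζ) ∂(multivariateGaussian 0 (D.C t)) with hHZdef
  set W : ℝ := ∫ ζ, Real.exp (-V₀ (φ + ζ)) * F (φ + ζ) ∂(multivariateGaussian 0 (D.C t))
    with hWdef
  set gW : EuclideanSpace ℝ (Fin N) →L[ℝ] ℝ := ∫ ζ, DK (φ + ζ) ∂(multivariateGaussian 0 (D.C t))
    with hgWdef
  set HW : EuclideanSpace ℝ (Fin N) →L[ℝ] EuclideanSpace ℝ (Fin N) →L[ℝ] ℝ :=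
    ∫ ζ, D2K (φ + ζ) ∂(multivariateGaussian 0 (D.C t)) with hHWdef
  obtain ⟨hV, -, -, hKb⟩ := basic_bounds hG1 hb hFb
  have hD2c : Continuous D2 := hUC.continuous
  have hD2Kc : Continuous D2K := hUC'.continuous
  have hDKc : Continuous DK := continuous_iff_continuousAt.2 fun x => (hF2 x).continuousAt
  have hne : Z ≠ 0 := (integral_exp_neg_pos hV hb _ φ).ne'
  have hne2 : Z ^ 2 ≠ 0 := pow_ne_zero 2 hne
  -- spatial derivatives of `Z`, `∇Z`, `W`, `∇W` at `φ`
  have hZ : HasFDerivAt (fun ψ => ∫ ζ, Real.exp (-V₀ (ψ + ζ)) ∂(multivariateGaussian 0 (D.C t)))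
      gZ φ := hasFDerivAt_integral_exp_neg D hG1 hG2 hb hK1 t φ
  have hgZ : HasFDerivAt (fun ψ => ∫ ζ, D1 (ψ + ζ) ∂(multivariateGaussian 0 (D.C t))) HZ φ :=
    hasFDerivAt_integral_fderiv_exp_neg D hG2 hK1 hM hD2c t φ
  have hW : HasFDerivAt
      (fun ψ => ∫ ζ, Real.exp (-V₀ (ψ + ζ)) * F (ψ + ζ) ∂(multivariateGaussian 0 (D.C t))) gW φ :=
    hasFDerivAt_integral_shift (G := fun x => Real.exp (-V₀ x) * F x) hF1 hDKc hKb hL1 _ φ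
  have hgW : HasFDerivAt (fun ψ => ∫ ζ, DK (ψ + ζ) ∂(multivariateGaussian 0 (D.C t))) HW φ :=
    hasFDerivAt_integral_shift hF2 hD2Kc hL1 hM' _ φ
  have hinv : HasFDerivAt
      (fun ψ => (∫ ζ, Real.exp (-V₀ (ψ + ζ)) ∂(multivariateGaussian 0 (D.C t)))⁻¹)
      ((-(Z ^ 2)⁻¹) • gZ) φ :=
    (hasDerivAt_inv hne).comp_hasFDerivAt φ hZ
  -- derivative of `ψ ↦ −1/Z(ψ)²`
  have hsq : HasFDerivAt
      (fun ψ => (∫ ζ, Real.exp (-V₀ (ψ + ζ)) ∂(multivariateGaussian 0 (D.C t))) ^ 2)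
      ((((2 : ℕ) : ℝ) * Z ^ (2 - 1)) • gZ) φ := by
    have h2 : HasDerivAt (fun x : ℝ => x ^ 2) (((2 : ℕ) : ℝ) * Z ^ (2 - 1)) Z := hasDerivAt_pow 2 Z
    exact h2.comp_hasFDerivAt φ hZ
  have hZ3 : ((Z ^ 2) ^ 2)⁻¹ * Z = Z⁻¹ * (Z ^ 2)⁻¹ :=
    calc ((Z ^ 2) ^ 2)⁻¹ * Z = (Z ^ 3)⁻¹ * (Z⁻¹ * Z) := by ring
      _ = (Z ^ 3)⁻¹ := by rw [inv_mul_cancel₀ hne, mul_one]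
      _ = Z⁻¹ * (Z ^ 2)⁻¹ := by ring
  have hc2 : HasFDerivAt
      (fun ψ => -((∫ ζ, Real.exp (-V₀ (ψ + ζ)) ∂(multivariateGaussian 0 (D.C t))) ^ 2)⁻¹)
      ((2 * (Z⁻¹ * (Z ^ 2)⁻¹)) • gZ) φ := by
    have h := ((hasDerivAt_inv hne2).comp_hasFDerivAt φ hsq).neg
    refine h.congr_fderiv ?_
    rw [smul_smul, ← neg_smul]
    congr 1
    rw [show (2 - 1 : ℕ) = 1 from rfl, pow_one, Nat.cast_ofNat]
    calc -(-((Z ^ 2) ^ 2)⁻¹ * (2 * Z)) = 2 * (((Z ^ 2) ^ 2)⁻¹ * Z) := by ring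
      _ = 2 * (Z⁻¹ * (Z ^ 2)⁻¹) := by rw [hZ3]
  have hInner : HasFDerivAt
      (fun ψ => (-((∫ ζ, Real.exp (-V₀ (ψ + ζ)) ∂(multivariateGaussian 0 (D.C t))) ^ 2)⁻¹) •
        ∫ ζ, D1 (ψ + ζ) ∂(multivariateGaussian 0 (D.C t)))
      ((-(Z ^ 2)⁻¹) • HZ + ((2 * (Z⁻¹ * (Z ^ 2)⁻¹)) • gZ).smulRight gZ) φ :=
    hc2.fun_smul hgZ
  have hA : HasFDerivAt
      (fun ψ => (∫ ζ, Real.exp (-V₀ (ψ + ζ)) ∂(multivariateGaussian 0 (D.C t)))⁻¹ •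
        ∫ ζ, DK (ψ + ζ) ∂(multivariateGaussian 0 (D.C t)))
      (Z⁻¹ • HW + ((-(Z ^ 2)⁻¹) • gZ).smulRight gW) φ :=
    hinv.fun_smul hgW
  have hB : HasFDerivAt
      (fun ψ => (∫ ζ, Real.exp (-V₀ (ψ + ζ)) * F (ψ + ζ) ∂(multivariateGaussian 0 (D.C t))) •
        ((-((∫ ζ, Real.exp (-V₀ (ψ + ζ)) ∂(multivariateGaussian 0 (D.C t))) ^ 2)⁻¹) •
          ∫ ζ, D1 (ψ + ζ) ∂(multivariateGaussian 0 (D.C t))))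
      (W • ((-(Z ^ 2)⁻¹) • HZ + ((2 * (Z⁻¹ * (Z ^ 2)⁻¹)) • gZ).smulRight gZ) +
        gW.smulRight ((-(Z ^ 2)⁻¹) • gZ)) φ :=
    hW.fun_smul hInner
  have hT2 := hA.fun_add hB
  -- the gradient field and the time derivative
  have hT1 := fun ψ => hasFDerivAt_semigroup_zero D hG1 hG2 hb hK1 hF1 hF2 hFb hL1 t ψ
  have hT0 := hasDerivAt_semigroup_zero D hG1 hG2 hb hM hUC hF1 hF2 hFb hM' hUC' ht φ
  refine ⟨_, _, hT1, hT2, hT0.congr_deriv ?_⟩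
  -- it remains to check the algebraic identity `−ŻW/Z² + Ẇ/Z = ½Δ_{Ċ}(W/Z) − (∇V, ∇(W/Z))_{Ċ}`
  beta_reduce
  rw [← hZdef, ← hWdef, ← hgZdef, ← hgWdef]
  have hHZ : ∀ i j : Fin N, (∫ x, D2 (φ + x) (EuclideanSpace.single i 1) (EuclideanSpace.single j 1)
      ∂(multivariateGaussian 0 (D.C t))) = HZ (EuclideanSpace.single i 1) (EuclideanSpace.single j 1) :=
    fun i j => (integral_fderiv₂_apply_single hG2 hK1 hM hD2c _ φ i j).symm
  have hHW : ∀ i j : Fin N, (∫ x, D2K (φ + x) (EuclideanSpace.single i 1) (EuclideanSpace.single j 1)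
      ∂(multivariateGaussian 0 (D.C t))) = HW (EuclideanSpace.single i 1) (EuclideanSpace.single j 1) :=
    fun i j => (integral_fderiv₂_apply_single hF2 hL1 hM' hD2Kc _ φ i j).symm
  have hgV : ∀ i : Fin N, (-(Z⁻¹ • gZ)) (EuclideanSpace.single i 1) =
      -(Z⁻¹ * gZ (EuclideanSpace.single i 1)) := fun i => by
    simp only [_root_.neg_apply, _root_.smul_apply, smul_eq_mul]
  have hgPe : ∀ j : Fin N, (Z⁻¹ • gW + W • ((-(Z ^ 2)⁻¹) • gZ)) (EuclideanSpace.single j 1) =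
      Z⁻¹ * gW (EuclideanSpace.single j 1) - W * (Z ^ 2)⁻¹ * gZ (EuclideanSpace.single j 1) :=
    fun j => by
    simp only [_root_.add_apply, _root_.smul_apply, smul_eq_mul]
    ring
  have hHPe : ∀ i j : Fin N,
      (Z⁻¹ • HW + ((-(Z ^ 2)⁻¹) • gZ).smulRight gW +
        (W • ((-(Z ^ 2)⁻¹) • HZ + ((2 * (Z⁻¹ * (Z ^ 2)⁻¹)) • gZ).smulRight gZ) +
          gW.smulRight ((-(Z ^ 2)⁻¹) • gZ))) (EuclideanSpace.single i 1) (EuclideanSpace.single j 1) =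
      Z⁻¹ * HW (EuclideanSpace.single i 1) (EuclideanSpace.single j 1) -
        (Z ^ 2)⁻¹ * (gZ (EuclideanSpace.single i 1) * gW (EuclideanSpace.single j 1)) -
        W * (Z ^ 2)⁻¹ * HZ (EuclideanSpace.single i 1) (EuclideanSpace.single j 1) +
        2 * W * Z⁻¹ * (Z ^ 2)⁻¹ * (gZ (EuclideanSpace.single i 1) * gZ (EuclideanSpace.single j 1)) -
        (Z ^ 2)⁻¹ * (gW (EuclideanSpace.single i 1) * gZ (EuclideanSpace.single j 1)) :=
    fun i j => by
    simp only [_root_.add_apply, _root_.smul_apply, smul_eq_mul, ContinuousLinearMap.smulRight_apply]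
    ring
  simp_rw [hHZ, hHW, hgV, hgPe, hHPe]
  -- split the double sums into the five elementary ones
  have hS1 : ∑ i, ∑ j, D.Cdot t i j *
      (Z⁻¹ * HW (EuclideanSpace.single i 1) (EuclideanSpace.single j 1) -
        (Z ^ 2)⁻¹ * (gZ (EuclideanSpace.single i 1) * gW (EuclideanSpace.single j 1)) -
        W * (Z ^ 2)⁻¹ * HZ (EuclideanSpace.single i 1) (EuclideanSpace.single j 1) +
        2 * W * Z⁻¹ * (Z ^ 2)⁻¹ * (gZ (EuclideanSpace.single i 1) * gZ (EuclideanSpace.single j 1)) -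
        (Z ^ 2)⁻¹ * (gW (EuclideanSpace.single i 1) * gZ (EuclideanSpace.single j 1))) =
      Z⁻¹ * (∑ i, ∑ j, D.Cdot t i j * HW (EuclideanSpace.single i 1) (EuclideanSpace.single j 1)) -
      (Z ^ 2)⁻¹ * (∑ i, ∑ j, D.Cdot t i j *
        (gZ (EuclideanSpace.single i 1) * gW (EuclideanSpace.single j 1))) -
      W * (Z ^ 2)⁻¹ * (∑ i, ∑ j, D.Cdot t i j *
        HZ (EuclideanSpace.single i 1) (EuclideanSpace.single j 1)) +
      2 * W * Z⁻¹ * (Z ^ 2)⁻¹ * (∑ i, ∑ j, D.Cdot t i j *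
        (gZ (EuclideanSpace.single i 1) * gZ (EuclideanSpace.single j 1))) -
      (Z ^ 2)⁻¹ * (∑ i, ∑ j, D.Cdot t i j *
        (gW (EuclideanSpace.single i 1) * gZ (EuclideanSpace.single j 1))) := by
    simp only [Finset.mul_sum, ← Finset.sum_sub_distrib, ← Finset.sum_add_distrib]
    refine Finset.sum_congr rfl fun i _ => Finset.sum_congr rfl fun j _ => ?_
    ring
  have hS2 : ∑ i, ∑ j, D.Cdot t i j * -(Z⁻¹ * gZ (EuclideanSpace.single i 1)) *
      (Z⁻¹ * gW (EuclideanSpace.single j 1) - W * (Z ^ 2)⁻¹ * gZ (EuclideanSpace.single j 1)) =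
      -(Z⁻¹ * Z⁻¹) * (∑ i, ∑ j, D.Cdot t i j *
        (gZ (EuclideanSpace.single i 1) * gW (EuclideanSpace.single j 1))) +
      W * Z⁻¹ * (Z ^ 2)⁻¹ * (∑ i, ∑ j, D.Cdot t i j *
        (gZ (EuclideanSpace.single i 1) * gZ (EuclideanSpace.single j 1))) := by
    simp only [Finset.mul_sum, ← Finset.sum_add_distrib]
    refine Finset.sum_congr rfl fun i _ => Finset.sum_congr rfl fun j _ => ?_
    ring
  -- symmetry of `Ċ_t`: `Σ Ċ^{ij} ∂_iW ∂_jZ = Σ Ċ^{ij} ∂_iZ ∂_jW`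
  have hsymm : ∑ i, ∑ j, D.Cdot t i j *
      (gW (EuclideanSpace.single i 1) * gZ (EuclideanSpace.single j 1)) =
      ∑ i, ∑ j, D.Cdot t i j *
        (gZ (EuclideanSpace.single i 1) * gW (EuclideanSpace.single j 1)) := by
    rw [Finset.sum_comm]
    refine Finset.sum_congr rfl fun j _ => Finset.sum_congr rfl fun i _ => ?_
    rw [D.Cdot_symm ht.le j i]
    ring
  rw [hS1, hS2, hsymm]
  ring

/-- **The integrand of the entropy production formula** ([BBD] proof of Theorem 3, display
p0016 L47–75: «using (e:polchinski-L), `L_t(Φ(F_t)) − Φ'(F_t)Ḟ_t = Φ'(F_t)L_tF_t + ½Φ''(F_t)(∇F_t)²_{Ċ_t}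
− Φ'(F_t)Ḟ_t = ½Φ''(F_t)(∇F_t)²_{Ċ_t}`», with `F_t = P_{0,t}F`, `Ḟ_t = L_tF_t`).  Pointwise form: for
`Φ ∈ C²(ℝ)` and `t > 0`, with `gP`, `HP` the first/second derivatives of `F_t = P_{0,t}F` (certified) and
`∇Φ(F_t) = Φ'(F_t)∇F_t`, `Hess Φ(F_t) = Φ'(F_t) Hess F_t + Φ''(F_t) ∇F_t ⊗ ∇F_t` (certified),
`∂_t Φ(F_t)(φ) = ½Δ_{Ċ_t}Φ(F_t)(φ) − (∇V_t, ∇Φ(F_t))_{Ċ_t}(φ) − ½ Φ''(F_t(φ)) (∇F_t(φ))²_{Ċ_t}`,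
i.e. `(∂_t − L_t)Φ(F_t) = −½Φ''(F_t)(∇F_t)²_{Ċ_t}`.  (The dual identity `−∂_tE_{ν_t} = E_{ν_t}L_t`
that turns this into (e:dEnt) is not in this file.)
[cite: BauerschmidtBodineauDagallier2023, Theorem 3 (proof, (e:dEnt))] -/
theorem hasDerivAt_comp_semigroup_zero
    (hG1 : ∀ x, HasFDerivAt (fun x => Real.exp (-V₀ x)) (D1 x) x)
    (hG2 : ∀ x, HasFDerivAt D1 (D2 x) x) {b : ℝ} (hb : ∀ φ, b ≤ V₀ φ)
    {K1 : ℝ} (hK1 : ∀ x, ‖D1 x‖ ≤ K1) {M : ℝ} (hM : ∀ x, ‖D2 x‖ ≤ M) (hUC : UniformContinuous D2)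
    (hF1 : ∀ x, HasFDerivAt (fun x => Real.exp (-V₀ x) * F x) (DK x) x)
    (hF2 : ∀ x, HasFDerivAt DK (D2K x) x) {KF : ℝ} (hFb : ∀ x, |F x| ≤ KF)
    {L1 : ℝ} (hL1 : ∀ x, ‖DK x‖ ≤ L1) {M' : ℝ} (hM' : ∀ x, ‖D2K x‖ ≤ M')
    (hUC' : UniformContinuous D2K) {Φ Φ' Φ'' : ℝ → ℝ} (hΦ1 : ∀ y, HasDerivAt Φ (Φ' y) y)
    (hΦ2 : ∀ y, HasDerivAt Φ' (Φ'' y) y) {t : ℝ} (ht : 0 < t) (φ : EuclideanSpace ℝ (Fin N)) :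
    ∃ (gP : EuclideanSpace ℝ (Fin N) → EuclideanSpace ℝ (Fin N) →L[ℝ] ℝ)
      (HP : EuclideanSpace ℝ (Fin N) →L[ℝ] EuclideanSpace ℝ (Fin N) →L[ℝ] ℝ),
      (∀ ψ, HasFDerivAt (fun ψ => semigroup D V₀ 0 t F ψ) (gP ψ) ψ) ∧
      HasFDerivAt gP HP φ ∧
      (∀ ψ, HasFDerivAt (fun ψ => Φ (semigroup D V₀ 0 t F ψ))
        (Φ' (semigroup D V₀ 0 t F ψ) • gP ψ) ψ) ∧
      HasFDerivAt (fun ψ => Φ' (semigroup D V₀ 0 t F ψ) • gP ψ)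
        (Φ' (semigroup D V₀ 0 t F φ) • HP +
          (Φ'' (semigroup D V₀ 0 t F φ) • gP φ).smulRight (gP φ)) φ ∧
      HasDerivAt (fun s => Φ (semigroup D V₀ 0 s F φ))
        ((1 / 2) * ∑ i, ∑ j, D.Cdot t i j *
            (Φ' (semigroup D V₀ 0 t F φ) • HP +
              (Φ'' (semigroup D V₀ 0 t F φ) • gP φ).smulRight (gP φ))
              (EuclideanSpace.single i 1) (EuclideanSpace.single j 1) -
          ∑ i, ∑ j, D.Cdot t i j *
            (-((∫ ζ, Real.exp (-V₀ (φ + ζ)) ∂(multivariateGaussian 0 (D.C t)))⁻¹ •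
                ∫ ζ, D1 (φ + ζ) ∂(multivariateGaussian 0 (D.C t)))) (EuclideanSpace.single i 1) *
              (Φ' (semigroup D V₀ 0 t F φ) • gP φ) (EuclideanSpace.single j 1) -
          (1 / 2) * Φ'' (semigroup D V₀ 0 t F φ) * ∑ i, ∑ j, D.Cdot t i j *
            (gP φ (EuclideanSpace.single i 1) * gP φ (EuclideanSpace.single j 1))) t := by
  obtain ⟨gP, HP, hT1, hT2, hT3⟩ := hasDerivAt_semigroup_zero_eq_generator D hG1 hG2 hb hK1 hM hUC
    hF1 hF2 hFb hL1 hM' hUC' ht φ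
  set Z : ℝ := ∫ ζ, Real.exp (-V₀ (φ + ζ)) ∂(multivariateGaussian 0 (D.C t)) with hZdef
  set gZ : EuclideanSpace ℝ (Fin N) →L[ℝ] ℝ := ∫ ζ, D1 (φ + ζ) ∂(multivariateGaussian 0 (D.C t))
    with hgZdef
  -- chain rules in `φ`
  have hQ1 : ∀ ψ, HasFDerivAt (fun ψ => Φ (semigroup D V₀ 0 t F ψ))
      (Φ' (semigroup D V₀ 0 t F ψ) • gP ψ) ψ := fun ψ => by
    have h := hΦ1 (semigroup D V₀ 0 t F ψ)
    exact h.comp_hasFDerivAt ψ (hT1 ψ)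
  have hc : HasFDerivAt (fun ψ => Φ' (semigroup D V₀ 0 t F ψ))
      (Φ'' (semigroup D V₀ 0 t F φ) • gP φ) φ := by
    have h := hΦ2 (semigroup D V₀ 0 t F φ)
    exact h.comp_hasFDerivAt φ (hT1 φ)
  have hQ2 : HasFDerivAt (fun ψ => Φ' (semigroup D V₀ 0 t F ψ) • gP ψ)
      (Φ' (semigroup D V₀ 0 t F φ) • HP +
        (Φ'' (semigroup D V₀ 0 t F φ) • gP φ).smulRight (gP φ)) φ :=
    hc.fun_smul hT2
  -- chain rule in `t`
  have hQt : HasDerivAt (fun s => Φ (semigroup D V₀ 0 s F φ))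
      (Φ' (semigroup D V₀ 0 t F φ) *
        ((1 / 2) * ∑ i, ∑ j, D.Cdot t i j *
            HP (EuclideanSpace.single i 1) (EuclideanSpace.single j 1) -
          ∑ i, ∑ j, D.Cdot t i j * (-(Z⁻¹ • gZ)) (EuclideanSpace.single i 1) *
            gP φ (EuclideanSpace.single j 1))) t := by
    have h := hΦ1 (semigroup D V₀ 0 t F φ)
    exact h.comp t hT3
  refine ⟨gP, HP, hT1, hT2, hQ1, hQ2, hQt.congr_deriv ?_⟩
  -- algebra
  set P : ℝ := semigroup D V₀ 0 t F φ with hPdef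
  have hgV : ∀ i : Fin N, (-(Z⁻¹ • gZ)) (EuclideanSpace.single i 1) =
      -(Z⁻¹ * gZ (EuclideanSpace.single i 1)) := fun i => by
    simp only [_root_.neg_apply, _root_.smul_apply, smul_eq_mul]
  have hgQ : ∀ j : Fin N, (Φ' P • gP φ) (EuclideanSpace.single j 1) =
      Φ' P * gP φ (EuclideanSpace.single j 1) := fun j => by
    simp only [_root_.smul_apply, smul_eq_mul]
  have hHQ : ∀ i j : Fin N, (Φ' P • HP + (Φ'' P • gP φ).smulRight (gP φ))
      (EuclideanSpace.single i 1) (EuclideanSpace.single j 1) =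
      Φ' P * HP (EuclideanSpace.single i 1) (EuclideanSpace.single j 1) +
        Φ'' P * (gP φ (EuclideanSpace.single i 1) * gP φ (EuclideanSpace.single j 1)) :=
    fun i j => by
    simp only [_root_.add_apply, _root_.smul_apply, smul_eq_mul, ContinuousLinearMap.smulRight_apply]
    ring
  simp_rw [hgV, hgQ, hHQ]
  have hS1 : ∑ i, ∑ j, D.Cdot t i j *
      (Φ' P * HP (EuclideanSpace.single i 1) (EuclideanSpace.single j 1) +
        Φ'' P * (gP φ (EuclideanSpace.single i 1) * gP φ (EuclideanSpace.single j 1))) =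
      Φ' P * (∑ i, ∑ j, D.Cdot t i j * HP (EuclideanSpace.single i 1) (EuclideanSpace.single j 1)) +
      Φ'' P * (∑ i, ∑ j, D.Cdot t i j *
        (gP φ (EuclideanSpace.single i 1) * gP φ (EuclideanSpace.single j 1))) := by
    simp only [Finset.mul_sum, ← Finset.sum_add_distrib]
    refine Finset.sum_congr rfl fun i _ => Finset.sum_congr rfl fun j _ => ?_
    ring
  have hS2 : ∑ i, ∑ j, D.Cdot t i j * -(Z⁻¹ * gZ (EuclideanSpace.single i 1)) *
      (Φ' P * gP φ (EuclideanSpace.single j 1)) =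
      Φ' P * (∑ i, ∑ j, D.Cdot t i j * -(Z⁻¹ * gZ (EuclideanSpace.single i 1)) *
        gP φ (EuclideanSpace.single j 1)) := by
    simp only [Finset.mul_sum]
    refine Finset.sum_congr rfl fun i _ => Finset.sum_congr rfl fun j _ => ?_
    ring
  rw [hS1, hS2]
  ring

end Generator

end Polchinski

end Literature.Analysis.FunctionSpaces

end
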